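import Literature.MathematicalPhysics.QuantumFieldTheory.Balaban1983to89.B8Ineq172Concrete
import Literature.MathematicalPhysics.QuantumFieldTheory.Balaban1983to89.B8Eq178Averages

/-!
# `Balaban1983to89.B8Eq1115Concrete` — T. Bałaban, *Spaces of regular gauge field configurations on a lattice and gauge fixing
# conditions*, Commun. Math. Phys. **99** (1985) 75–102 [Balaban1985RegularSpaces] ("B8"), proof of Theorem 4, pp. 89–90 and
# (1.115)/(1.121) p. 96: «the assumptions of Proposition 10 [of [3]] are satisfied and we have the representation (213) and the
# bounds (214) [3]» FOR THE INDUCTIVE GAUGE TRANSFORMATION `u₁` — ON THE CONCRETE `ℤᵈ` CARRIERS, AT A GENERAL BACKGROUND, WITH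
# PRINT'S LOCAL (block-tower) HYPOTHESES

statement-level skeleton of published theorems with citation tags; proofs where landed; nothing here is a claim about the
Yang–Mills mass gap

PDF held: `paper:balaban1985-cmp99-regular-spaces-gauge-fixing` (journal page = PDF page + 74); pp. 89–90 [PDF 15–16] and p. 96
[PDF 22] on the text layer, p. 88 [PDF 14] as an image (this seat, 2026-08-25); [3] = [Balaban1985Averaging], Proposition 10 p. 50,
(207), (213)–(214) p. 50, as quoted and proved at a general background in `B7Prop10General` / `B7Eq214General`.

WHAT IS PRINTED (verbatim).  p. 89: "The estimates (1.75), (1.76) imply that `u′` satisfies the regularity conditions (176), (177)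
[3] on `Ω_j ⊂ T_{L^{−j}}` with `α₄ = 32dB₁(α₀ + α₁)`. The estimates (1.73), (1.74) together with the condition `\overline{R₀u₁ʲ} = 1`
on `Λ_j` imply that `u₁` satisfies (166), (167) [3] on `Bʲ(Λ_j) ⊂ T_{L^{−j}}` with `α₃ = 16dB₁(α₀ + α₁)`, thus for `α₀ + α₁`
sufficiently small the assumptions of Proposition 10 are satisfied and we have the representation (213) and the bounds (214) [3]."
p. 90: "Thus we consider the set of configurations `u′ = e^{iλ}` with `λ` satisfying `|λ| < α₄`, `|(Dλ)(b)| < α₄(Lʲη)⁻¹` for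
`b ∈ Ω_j`, `j = 0, 1, …, k − 1`, (1.77) where `α₄` is sufficiently small, but otherwise arbitrary … These conditions imply the
regularity conditions (176), (177) on `Ω_j ⊂ T_{L^{−j}}` with `4α₄` instead of `α₄`. The configuration `u₁` is fixed and determined by
`U₁`, hence we keep the same meaning of `α₃` as before".  p. 96: "Using the equality (213) [3] we have `Q′(u₁, λ − H′D′(λ)) =
Q′(λ − H′D′(λ)) + C′(λ − H′D′(λ))` (1.115)"; "By the inequality (214) we have `|C′(λ − H′X)| < C′₂(α₃ + α₄)α₄`. (1.121)".

WHY THIS FILE.  The tree proves (213)–(214) at a general background (`B7Eq214General.eq214_general_of207`, B8 transport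
`B8Eq178Averages.eq214_qprimeIter_of207`) from GLOBAL hypotheses: (52) on all of `ℤᵈ`, (207) for `λ` everywhere, and `u₁ ∈ Λ_k(U₀, α₃)`
((166)–(167)) everywhere — with the located note (docstring of `eq214_qprimeIter_of207`): «B8 applies (214) under its region-dependent
(1.119)–(1.120) on `{Ω_j}`; that refinement is not typed here».  THIS FILE types and proves it for the INDUCTIVE `u₁` of Theorem 4
(the gauge fixing (104)–(106) of [3] at top level `j`, whose local (166)–(167) are `B8Ineq172Concrete` = (1.73)/(1.74)): on the block
tower under a level-`j` site `y` (`Bʲ(y) ⊂ Ω_j`), with (1.33) and (1.69) assumed on the fine block `Bʲ(y)` ONLY and (1.77) in its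
(207)-form assumed for `λ` on `Bʲ(y)` ONLY, the remainder `C′_m(u₁, λ)(z) = log ũ′ᵐ(z) − (Q′_mλ)(z)` obeys (214) at every site of the
tower, with the region constants (`η ↦ L^{−j}`: `Ω_j ⊂ T_{L^{−j}}`) and NO condition involving `j`.  Device (the tree's, `B7Prop1Local`,
`B8Ineq130.ineq130_local`): clamped extension of the background and OF THE SITE FUNCTION `λ` (`λ ∘ π`), zero extension of the field, the
global theorem, transfer by the locality of every quantity on the tower (§1 here + `B8Ineq172Concrete` §1).

WHAT THIS FILE PROVES (kernel, 0 sorry, theorems only, no `def`; tower `[tlo L y n, thi L y n]` of `B8Ineq130` with `lo = hi = y`).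
* §1 LOCALITY on the tower of the gauge-transformation averages of Sect. F of [3]: the one-step operation `ṽ′` (178)/(179) and its iterate
  `ũ′ᵐ` (`B7Prop10General.utilG`), and the linear averaging `Q′_m` (211)–(213) (`B7Eq214General.lamAvgG`) — `utilG_congr_tower`,
  `lamAvgG_congr_tower` (any background; from `B8Ineq172Concrete.uavg_congr_tower`/`hol_block_congr`).
* §2 THE CLAMPED SITE FUNCTION `λ ∘ π` (`π` = `B7Prop1Local.clamp`): it agrees with `λ` on `Bʲ(y)` and inherits (207) GLOBALLY with respect
  to the clamped background from (207) on the bonds of `Bʲ(y)` (`lam_clamp_eq`, `h207b_clamp`, `h207a_clamp`).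
* §3 **`eq214_local`** — (213)–(214) of [3] = the input of (1.115)/(1.121), for `u₁ = glev L _ U₀ e^{B} j 0` and `u′ = e^{λ}`, at every
  level-`m` site of the tower: `‖log ũ′ᵐ(z) − (Q′_mλ)(z)‖ ≤ 16C′_gen·(α₃α₄ + α₄²)·Lᵐ·L^{−j}` with `α₃ = 40d·(Lʲb)`, under: `U₀` `G`-valued
  and regular on `Bʲ(y)` (`pdevOn < α₀L^{−2j}`), `|B_b| ≤ b` on the bonds of `Bʲ(y)`, `‖λ(x)‖ < α₄` on the sites and
  `‖R(U₀(b))λ(b₊) − λ(b₋)‖ < α₄L^{−j}` on the bonds of `Bʲ(y)`, and the smallness lists of `B7Eq167General` (k = j) and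
  `B7Eq214General.eq214_general_of207` (conditions on `α₀`, `Lʲb`, `α₄` only); `eq214_local_B8` — the same in B8's vocabulary
  (`B8Eq178Averages.Qnl` = `Q′_m(u₁, λ)` (208), `QprimeIter (zdBlocking d L) (bgT L U₀) m` = `Q′_m` of (1.27)–(1.29)) and in print's letters
  `b = c·L^{−j}`, `α₃ = 40d·c`.

READINGS / DECLARED DEVIATIONS: those of `B8Ineq172Concrete` and `B7Eq214General` (explicit constants `C′_gen = 8832(d+1)C₆`, `α₃ = 40d·c` for
print's `16dB₁(α₀+α₁)`; `≤` for `<`; `ℤᵈ` per level; `G ⊂ U1` averaging-closed); (1.77) is taken in the (207)-form of [3] at the scale of `Ω_j`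
(`‖R(U₀(b))λ(b₊) − λ(b₋)‖ < α₄L^{−j}` = `η|(Dλ)(b)| < α₄η(Lʲη)⁻¹`), cf. `B8Eq178Averages.Cond177`/`reg177_of_cond177`; `u₁` = the constructed
`glev` (as in `B8Ineq172Concrete`).  NOT CLAIMED: (1.75)–(1.76) for `u′` (they concern the solution, `B8Eq178Averages.ineq175/176`), Sect. E, and
anything of Theorem 4 itself.  Unit `pub-ymgap-dag-n04-b` (YM Track A, node N05 [B8]), 2026-08-25.  Tree API by name only, nothing restated.
-/

noncomputable section

open NormedSpace Finset

namespace Literature.MathematicalPhysics.QuantumFieldTheory.Balaban1983to89.B8Eq1115Concrete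

open B7Prop1Explicit B7Prop2Explicit B7Prop3Flat B7Prop1Local B7Eq92Concrete B7Eq99Concrete B7Eq84Concrete B7Eq167Flat B7Eq167General
open MatrixLog (mlog)
open B7Eq170Flat (cj cj_apply bmean bmean_apply)
open B7Prop9General (vtilG vtilG_apply)
open B7Prop10General (utilG utilG_zero utilG_succ C6 C4G)
open B7Eq214General (rlam rlam_apply lamAvgG lamAvgG_zero lamAvgG_succ Cgen eq214_general_of207)
open B7Prop5Flat (bondsIn restr)
open B8Ineq130 (fl tlo thi tlo_zero thi_zero block_mem smul_mem inBox_of_le)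
open B8Ineq172Concrete (hol_block_congr glev_congr_tower uavg_congr_tower)
open B8Eq178Averages (Qnl Qnl_eq_mlog_utilG qprimeIter_bgT_eq_lamAvgG)

-- `Site` alone could resolve to the torus sites of `Setup.lean`; re-export the `ℤ^d` sites of `B7Prop1Explicit`.
export B7Prop1Explicit (Site)

variable {d : ℕ}

/-! ## §1 Locality of `ũ′ᵐ` (178)/(179) and of `Q′_m` (211)–(213) of [3] on the block tower -/

section Congr

variable {𝔸 : Type*} [NormedRing 𝔸] [NormOneClass 𝔸] [NormedAlgebra ℂ 𝔸] [CompleteSpace 𝔸]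
variable {L : ℕ} {j : ℕ} {y : Site d} {U₀ U₀' : Site d → Fin d → 𝔸ˣ}

omit [NormOneClass 𝔸] in
/-- Locality of the twisted site average (78) of [3] on the tower: for site functions `v`, `v′` equal on the level-`m` sites of
`B^{n+1}(y)` (`n + (m+1) = j`) and backgrounds agreeing on the fine block, `(\overline{R₀v})(Lz) = (\overline{R₀v′})(Lz)` at the
background `Ū₀ᵐ`, for every level-`(m+1)` site `z` of `Bⁿ(y)`. [cite: Balaban1985Averaging, (78) p.30, p.24] -/
theorem R0avg_congr_tower (hL : 1 ≤ L) (h₀ : AgreeOn (tlo L y j) (thi L y j) U₀ U₀') {m n : ℕ} (hmn : n + (m + 1) = j)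
    {v v' : Site d → 𝔸ˣ} (hv : ∀ x : Site d, tlo L y (n + 1) ≤ x → x ≤ thi L y (n + 1) → v x = v' x)
    {z : Site d} (hz : tlo L y n ≤ z) (hz' : z ≤ thi L y n) :
    R0avg L (avgIter L U₀ m) v ((L : ℤ) • z) = R0avg L (avgIter L U₀' m) v' ((L : ℤ) • z) := by
  obtain ⟨h1, h2⟩ := smul_mem hL hz hz'
  rw [R0avg, R0avg]
  refine savg_congr L ?_ fun r => ?_
  · rw [R0fun_self, R0fun_self, hv _ h1 h2]
  · obtain ⟨h3, h4⟩ := block_mem hz hz' r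
    simp only [R0fun_apply, add_sub_cancel_left]
    rw [hol_block_congr hL h₀ hmn hz hz' r, hv _ h3 h4]

omit [NormOneClass 𝔸] in
/-- **Locality of `ũ′ᵐ` (178)/(179) of [3]** (`B7Prop10General.utilG`) on the tower: for `(U₀, u′, u₁)` and `(U₀′, u″, u₁′)` with the backgrounds
agreeing on the bonds of the fine block `Bʲ(y)` and the gauge transformations equal on its sites, `ũ′ᵐ(z) = ũ″ᵐ(z)` at every level-`m` site `z`
of `Bⁿ(y)`, `n + m = j`. [cite: Balaban1985Averaging, (178)–(179) p.45, p.24] -/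
theorem utilG_congr_tower (hL : 1 ≤ L) (h₀ : AgreeOn (tlo L y j) (thi L y j) U₀ U₀') {u' u'' u₁ u₁' : Site d → 𝔸ˣ}
    (hu' : ∀ x : Site d, tlo L y j ≤ x → x ≤ thi L y j → u' x = u'' x)
    (hu₁ : ∀ x : Site d, tlo L y j ≤ x → x ≤ thi L y j → u₁ x = u₁' x) :
    ∀ (m n : ℕ), n + m = j → ∀ z : Site d, tlo L y n ≤ z → z ≤ thi L y n →
      utilG L U₀ u' u₁ m z = utilG L U₀' u'' u₁' m z
  | 0, n, hn, z, hz, hz' => by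
    have hnj : n = j := by omega
    subst hnj
    rw [utilG_zero, utilG_zero, hu' z hz hz']
  | m + 1, n, hmn, z, hz, hz' => by
    rw [utilG_succ, utilG_succ]
    simp only [vtilG_apply]
    have hu1 : ∀ x : Site d, tlo L y (n + 1) ≤ x → x ≤ thi L y (n + 1) → uavg L U₀ u₁ m x = uavg L U₀' u₁' m x :=
      fun x hx hx' => uavg_congr_tower hL h₀ hu₁ m (n + 1) (by omega) x hx hx'
    have hprod : ∀ x : Site d, tlo L y (n + 1) ≤ x → x ≤ thi L y (n + 1) →
        (utilG L U₀ u' u₁ m * uavg L U₀ u₁ m) x = (utilG L U₀' u'' u₁' m * uavg L U₀' u₁' m) x := fun x hx hx' => by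
      rw [Pi.mul_apply, Pi.mul_apply, utilG_congr_tower hL h₀ hu' hu₁ m (n + 1) (by omega) x hx hx', hu1 x hx hx']
    rw [R0avg_congr_tower hL h₀ hmn hprod hz hz', R0avg_congr_tower hL h₀ hmn hu1 hz hz']

omit [NormOneClass 𝔸] in
/-- **Locality of the linear averaging `Q′_m` (211)–(213) of [3]** (`B7Eq214General.lamAvgG`) on the tower: for `λ`, `λ′` equal on the sites of
`Bʲ(y)` and backgrounds agreeing on its bonds, `(Q′_mλ)(z) = (Q′_mλ′)(z)` at every level-`m` site `z` of `Bⁿ(y)`, `n + m = j`.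
[cite: Balaban1985Averaging, (211)–(213) p.50, p.24] -/
theorem lamAvgG_congr_tower (hL : 1 ≤ L) (h₀ : AgreeOn (tlo L y j) (thi L y j) U₀ U₀') {lam lam' : Site d → 𝔸}
    (hlam : ∀ x : Site d, tlo L y j ≤ x → x ≤ thi L y j → lam x = lam' x) :
    ∀ (m n : ℕ), n + m = j → ∀ z : Site d, tlo L y n ≤ z → z ≤ thi L y n →
      lamAvgG L U₀ m lam z = lamAvgG L U₀' m lam' z
  | 0, n, hn, z, hz, hz' => by
    have hnj : n = j := by omega
    subst hnj
    rw [lamAvgG_zero, lamAvgG_zero, hlam z hz hz']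
  | m + 1, n, hmn, z, hz, hz' => by
    rw [lamAvgG_succ, lamAvgG_succ, rlam_apply, rlam_apply, bmean_apply, bmean_apply]
    refine Finset.sum_congr rfl fun r _ => ?_
    obtain ⟨h3, h4⟩ := block_mem hz hz' r
    rw [hol_block_congr hL h₀ hmn hz hz' r, lamAvgG_congr_tower hL h₀ hlam m (n + 1) (by omega) _ h3 h4]

end Congr

/-! ## §2 The clamped site function `λ ∘ π` and the global (207) from the local one -/

section Clamp

variable {𝔸 : Type*} [NormedRing 𝔸] [NormedAlgebra ℂ 𝔸] [CompleteSpace 𝔸]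
variable {lo hi : Site d} {V : Site d → Fin d → 𝔸ˣ} {lam : Site d → 𝔸} {α β : ℝ}

omit [NormedRing 𝔸] [NormedAlgebra ℂ 𝔸] [CompleteSpace 𝔸] in
/-- `λ ∘ π = λ` on the box (device of this file, not in print). [cite: Balaban1985RegularSpaces, (1.77) p.90] -/
private theorem lam_clamp_eq {x : Site d} (hx : InBox lo hi x) : lam (clamp lo hi x) = lam x := by
  rw [clamp_of_inBox hx]

omit [NormedAlgebra ℂ 𝔸] [CompleteSpace 𝔸] in
/-- (207b) «`|λ(x)| < α₄`» for `λ ∘ π` everywhere from the same on the box. [cite: Balaban1985Averaging, (207) p.50] -/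
private theorem h207b_clamp (hlohi : ∀ i, lo i ≤ hi i) (h : ∀ x : Site d, InBox lo hi x → ‖lam x‖ < α) (x : Site d) :
    ‖lam (clamp lo hi x)‖ < α :=
  h _ (clamp_inBox hlohi x)

omit [NormedAlgebra ℂ 𝔸] [CompleteSpace 𝔸] in
/-- (207a) «`|R(V₀(b))λ(b₊) − λ(b₋)| < α₄η`» for `λ ∘ π` with respect to the CLAMPED background `π*V` everywhere, from the same on the bonds of
the box: on a genuine bond the expression is that of the bond `⟨π(x), π(x) + e_κ⟩ ⊂` box, on a degenerate one the transport is `1` and the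
two values coincide. [cite: Balaban1985Averaging, (207) p.50] -/
private theorem h207a_clamp (hlohi : ∀ i, lo i ≤ hi i) (hβ : 0 < β)
    (h : ∀ (x : Site d) (κ : Fin d), InBox lo hi x → InBox lo hi (x + e κ) → ‖cj (V x κ) (lam (x + e κ)) - lam x‖ < β)
    (x : Site d) (κ : Fin d) :
    ‖cj (clampCfg lo hi V x κ) (lam (clamp lo hi (x + e κ))) - lam (clamp lo hi x)‖ < β := by
  by_cases hP : lo κ ≤ x κ ∧ x κ < hi κ
  · have hx := clamp_inBox hlohi x
    have hxe : InBox lo hi (clamp lo hi x + e κ) := by rw [← clamp_add_e_of hP]; exact clamp_inBox hlohi _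
    simp only [clampCfg, hP, and_self, if_true, clamp_add_e_of hP]
    exact h _ κ hx hxe
  · simp only [clampCfg, hP, if_false, clamp_add_e_of_not (hlohi κ) hP, cj_apply, Units.val_one, inv_one, one_mul,
      mul_one, sub_self, norm_zero]
    exact hβ

end Clamp

/-! ## §3 (213)–(214) of [3] for the inductive `u₁` on the block tower — the input of (1.115)/(1.121), local hypotheses -/

section Local

variable {𝔸 : Type*} [NormedRing 𝔸] [NormOneClass 𝔸] [NormedAlgebra ℂ 𝔸] [CompleteSpace 𝔸]
variable {L : ℕ} {G : Subgroup 𝔸ˣ} {j : ℕ} {y : Site d} {U₀ : Site d → Fin d → 𝔸ˣ} {α₀ α₄ : ℝ} {B : Site d → Fin d → 𝔸} {b : ℝ}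
  {lam : Site d → 𝔸}

omit [NormOneClass 𝔸] [NormedAlgebra ℂ 𝔸] [CompleteSpace 𝔸] in
/-- The zero extension of the field given on the bonds of a box inherits the local bound `|B_b| ≤ b` globally (device; cf.
`B8Ineq172Concrete`). [cite: Balaban1985RegularSpaces, (1.69) p.88] -/
private theorem norm_insCfg_restr_le {lo hi : Site d} (hb : 0 ≤ b)
    (hB : ∀ (x : Site d) (κ : Fin d), InBox lo hi x → InBox lo hi (x + e κ) → ‖B x κ‖ ≤ b) (x : Site d) (κ : Fin d) :
    ‖insCfg (bondsIn lo hi) (restr (bondsIn lo hi) B) x κ‖ ≤ b := by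
  by_cases h : (x, κ) ∈ bondsIn lo hi
  · rw [B7Prop5Flat.insCfg_restr_of_mem _ _ h]
    obtain ⟨hx, hx'⟩ := B7Prop5Flat.mem_bondsIn.mp h
    exact hB x κ hx hx'
  · simp only [insCfg, h, dite_false, norm_zero]
    exact hb

/-- **(213)–(214) OF [3] FOR THE INDUCTIVE `u₁`, LOCAL HYPOTHESES** (B8 pp. 89–90: «the assumptions of Proposition 10 are satisfied and
we have the representation (213) and the bounds (214) [3]»; used at (1.115)/(1.121) p. 96).  Setting: `L ≥ 2`, `G ⊂ U1` averaging-closed,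
`U₀` `G`-valued and regular ON THE FINE BLOCK `Bʲ(y)` ONLY (`sup_{p⊂Bʲ(y)}|U₀(∂p) − 1| < α₀L^{−2j}`, (1.33) at level `j`), `U₁ = e^{B}` with
`|B_b| ≤ b` on the bonds of `Bʲ(y)` ((1.69)), `u₁ = glev … j 0` THE gauge transformation (104)–(106) of [3] at top level `j` (B8's inductive
`u₁` on `Bʲ(Λ_j)`), `u′ = e^{λ}` with (1.77) in the (207)-form ON `Bʲ(y)` ONLY: `‖λ(x)‖ < α₄` at its sites, `‖R(U₀(b))λ(b₊) − λ(b₋)‖ < α₄L^{−j}`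
on its bonds; smallness = `B7Eq167General`'s at `k = j` (⇒ `u₁ ∈ Λ_j(U₀, α₃)` with `α₃ = 40d·Lʲb`, localised in `B8Ineq172Concrete`) and
`B7Eq214General.eq214_general_of207`'s.  THEN at every level-`m` site `z` of the block `Bⁿ(y)` (`n + m = j`):
`‖log ũ′ᵐ(z) − (Q′_mλ)(z)‖ ≤ 16C′_gen(α₃α₄ + α₄²)·Lᵐ·L^{−j}` — (213) with the remainder `C′_m(u₁, λ)` and (214) with the REGION scale
`L^{−j}` of `Ω_j ⊂ T_{L^{−j}}`.  Proof: clamped background, zero-extended field, clamped `λ ∘ π`; `eq214_general_of207` for them with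
`u₁ ↦` their gauge fixing (`inLambda_glev_general`, GLOBAL); transfer by §1 and `B8Ineq172Concrete.glev_congr_tower`.
[cite: Balaban1985RegularSpaces, p.89 (paragraph after (1.76)), (1.77) p.90, (1.115) p.96, (1.121) p.96; Balaban1985Averaging, Proposition 10 p.50, (213)–(214) p.50] -/
theorem eq214_local (hL : 2 ≤ L) (hG : AvgClosed d L G) (hU₀ : ∀ x κ, U₀ x κ ∈ G)
    (hα : 0 < α₀) (hα3 : C0 d * α₀ ≤ 1 / 3) (hα4 : 4 * α₀ ≤ c2' d L)
    (h33 : pdevOn (tlo L y j) (thi L y j) U₀ < α₀ * (((L : ℝ) ^ j)⁻¹) ^ 2) (hb : 0 ≤ b)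
    (h69 : ∀ (x : Site d) (κ : Fin d), InBox (tlo L y j) (thi L y j) x → InBox (tlo L y j) (thi L y j) (x + e κ) → ‖B x κ‖ ≤ b)
    (hsmall : Real.exp (4 * (800 * ((d : ℝ) + 1) ^ 2 * ((d : ℝ) + 4)) * α₀)
      * (1 + 8 * (131072 * ((d : ℝ) + 1) ^ 2) * ((L : ℝ) ^ j * b)) ≤ 2)
    (hc₃ : 2 * ((L : ℝ) ^ j * b) ≤ c3 d L) (hs : 128 * (d : ℝ) * ((L : ℝ) ^ j * b) ≤ 1) (hL1 : 1 ≤ L)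
    (hα₄ : 0 < α₄) (h177b : ∀ x : Site d, InBox (tlo L y j) (thi L y j) x → ‖lam x‖ < α₄)
    (h177a : ∀ (x : Site d) (κ : Fin d), InBox (tlo L y j) (thi L y j) x → InBox (tlo L y j) (thi L y j) (x + e κ) →
      ‖cj (U₀ x κ) (lam (x + e κ)) - lam x‖ < α₄ * ((L : ℝ) ^ j)⁻¹)
    (hα₃' : 40 * d * ((L : ℝ) ^ j * b) ≤ 1 / 200)
    (hs₁ : 200 * C6 d * α₄ ≤ 1) (hs₂ : 12000 * ((d : ℝ) + 1) * L * α₄ ≤ 1)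
    (hs₃ : C4G d L * (α₀ + 40 * d * ((L : ℝ) ^ j * b) + 4 * α₄) ≤ 1)
    (hs₄ : 1024 * ((d : ℝ) + 1) * ((d : ℝ) + 4) * L ^ 2 * α₀ ≤ 1) (hs₅ : 32 * ((d : ℝ) + 1) ^ 2 * C6 d * L ^ 2 * α₀ ≤ 1)
    (hs₆ : 16 * d * B7Prop9Flat.C5' d * C6 d * (L : ℝ) ^ 2 * α₀ ≤ 1) (hs₇ : 8 * d * C6 d * L * α₀ ≤ 1)
    {m n : ℕ} (hmn : n + m = j) (z : Site d) (hz : tlo L y n ≤ z) (hz' : z ≤ thi L y n) :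
    ‖mlog ((utilG L U₀ (fun x => expUnit (lam x)) (glev L hL1 U₀ (expCfg B) j 0) m z : 𝔸ˣ) : 𝔸) - lamAvgG L U₀ m lam z‖
      ≤ 16 * Cgen d * (40 * d * ((L : ℝ) ^ j * b) * α₄ + α₄ ^ 2) * ((L : ℝ) ^ m * ((L : ℝ) ^ j)⁻¹) := by
  have hlohi : ∀ i, tlo L y j i ≤ thi L y j i := B8Ineq130.tlo_le_thi hL1 le_rfl j
  have hUU : ∀ x κ, U₀ x κ ∈ U1 𝔸 := fun x κ => hG.le_U1 (hU₀ x κ)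
  -- the extended data
  set U₀c := clampCfg (tlo L y j) (thi L y j) U₀ with hU₀c_def
  set Bc := insCfg (bondsIn (tlo L y j) (thi L y j)) (restr (bondsIn (tlo L y j) (thi L y j)) B) with hBc_def
  set lamc : Site d → 𝔸 := fun x => lam (clamp (tlo L y j) (thi L y j) x) with hlamc_def
  have hU₀c : ∀ x κ, U₀c x κ ∈ G := clampCfg_mem hU₀
  have h52c : pdev U₀c < α₀ * (((L : ℝ) ^ j)⁻¹) ^ 2 := (pdev_clampCfg_le hlohi hUU).trans_lt h33
  have hBc : ∀ x κ, ‖Bc x κ‖ ≤ b := norm_insCfg_restr_le hb h69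
  have h₀ : AgreeOn (tlo L y j) (thi L y j) U₀ U₀c := (clampCfg_agree U₀).symm
  have h₁ : AgreeOn (tlo L y j) (thi L y j) (expCfg B) (expCfg Bc) := B7Prop5Flat.agreeOn_expCfg (B7Prop5Flat.agreeOn_insCfg_restr _ _ B)
  have h207b : ∀ x : Site d, ‖lamc x‖ < α₄ := h207b_clamp hlohi h177b
  have h207a : ∀ (x : Site d) (κ : Fin d), ‖cj (U₀c x κ) (lamc (x + e κ)) - lamc x‖ < α₄ * ((L : ℝ) ^ j)⁻¹ :=
    h207a_clamp hlohi (by positivity) h177a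
  -- `u₁ᶜ ∈ Λ_j(U₀ᶜ, 40d·Lʲb)` globally
  have hΛ := inLambda_glev_general hL hG hU₀c hα hα3 hα4 h52c hb hBc hsmall hc₃ hs hL1
  have hα₃ : (0 : ℝ) ≤ 40 * d * ((L : ℝ) ^ j * b) := by positivity
  have hglob := eq214_general_of207 hL hG hU₀c hα hα3 (by linarith) h52c h207a h207b hΛ hα₃ hα₃' hs₁ hs₂ hs₃ hs₄ hs₅ hs₆ hs₇ m
    (by omega) z
  -- transfer to the original data on the tower
  have hu' : ∀ x : Site d, tlo L y j ≤ x → x ≤ thi L y j → (fun x => expUnit (lam x)) x = (fun x => expUnit (lamc x)) x :=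
    fun x hx hx' => by simp only [hlamc_def, lam_clamp_eq (inBox_of_le hx hx')]
  have hlam : ∀ x : Site d, tlo L y j ≤ x → x ≤ thi L y j → lam x = lamc x :=
    fun x hx hx' => by simp only [hlamc_def, lam_clamp_eq (inBox_of_le hx hx')]
  rw [utilG_congr_tower hL1 h₀ hu' (glev_congr_tower hL1 h₀ h₁ j 0 (by omega)) m n hmn z hz hz',
    lamAvgG_congr_tower hL1 h₀ hlam m n hmn z hz hz']
  exact hglob

/-- **The same in B8's vocabulary and print's letters** — `Q′_m(u₁, λ) = B8Eq178Averages.Qnl` ((208) of [3]), `Q′_m = QprimeIter (zdBlocking d L)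
(bgT L U₀) m` (the operator of (1.27)–(1.29), [4] (3.19)), and (1.69) read as `|B_b| ≤ c·L^{−j}` on `Bʲ(y) ⊂ Ω_j` (`c = B₁(α₀ + α₁)`, so
`α₃ = 40d·c`): `‖Q′_m(u₁, λ)(z) − (Q′_mλ)(z)‖ ≤ 16C′_gen(40d·c·α₄ + α₄²)·Lᵐ·L^{−j}` at every level-`m` site of the tower — (1.115)'s remainder
`C′(λ)` with the bound (214)/(1.121), every smallness condition a condition on `α₀`, `c`, `α₄` ALONE (no `j`).
[cite: Balaban1985RegularSpaces, (1.115) p.96, (1.121) p.96, p.89; Balaban1985Averaging, (213)–(214) p.50] -/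
theorem eq214_local_B8 (hL : 2 ≤ L) (hG : AvgClosed d L G) (hU₀ : ∀ x κ, U₀ x κ ∈ G)
    (hα : 0 < α₀) (hα3 : C0 d * α₀ ≤ 1 / 3) (hα4 : 4 * α₀ ≤ c2' d L)
    (h33 : pdevOn (tlo L y j) (thi L y j) U₀ < α₀ * (((L : ℝ) ^ j)⁻¹) ^ 2) {c : ℝ} (hc : 0 ≤ c)
    (h69 : ∀ (x : Site d) (κ : Fin d), InBox (tlo L y j) (thi L y j) x → InBox (tlo L y j) (thi L y j) (x + e κ) →
      ‖B x κ‖ ≤ c * ((L : ℝ) ^ j)⁻¹)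
    (hsmall : Real.exp (4 * (800 * ((d : ℝ) + 1) ^ 2 * ((d : ℝ) + 4)) * α₀) * (1 + 8 * (131072 * ((d : ℝ) + 1) ^ 2) * c) ≤ 2)
    (hc₃ : 2 * c ≤ c3 d L) (hs : 128 * (d : ℝ) * c ≤ 1) (hL1 : 1 ≤ L)
    (hα₄ : 0 < α₄) (h177b : ∀ x : Site d, InBox (tlo L y j) (thi L y j) x → ‖lam x‖ < α₄)
    (h177a : ∀ (x : Site d) (κ : Fin d), InBox (tlo L y j) (thi L y j) x → InBox (tlo L y j) (thi L y j) (x + e κ) →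
      ‖cj (U₀ x κ) (lam (x + e κ)) - lam x‖ < α₄ * ((L : ℝ) ^ j)⁻¹)
    (hα₃' : 40 * d * c ≤ 1 / 200) (hs₁ : 200 * C6 d * α₄ ≤ 1) (hs₂ : 12000 * ((d : ℝ) + 1) * L * α₄ ≤ 1)
    (hs₃ : C4G d L * (α₀ + 40 * d * c + 4 * α₄) ≤ 1)
    (hs₄ : 1024 * ((d : ℝ) + 1) * ((d : ℝ) + 4) * L ^ 2 * α₀ ≤ 1) (hs₅ : 32 * ((d : ℝ) + 1) ^ 2 * C6 d * L ^ 2 * α₀ ≤ 1)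
    (hs₆ : 16 * d * B7Prop9Flat.C5' d * C6 d * (L : ℝ) ^ 2 * α₀ ≤ 1) (hs₇ : 8 * d * C6 d * L * α₀ ≤ 1)
    {m n : ℕ} (hmn : n + m = j) (z : Site d) (hz : tlo L y n ≤ z) (hz' : z ≤ thi L y n) :
    ‖Qnl L U₀ (fun x => expUnit (lam x)) (glev L hL1 U₀ (expCfg B) j 0) m z
        - B7Eq78Linearization.QprimeIter (B7Eq78Linearization.zdBlocking d L) (B8Eq119TwistedAxial.bgT L U₀) m lam z‖
      ≤ 16 * Cgen d * (40 * d * c * α₄ + α₄ ^ 2) * ((L : ℝ) ^ m * ((L : ℝ) ^ j)⁻¹) := by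
  have hLj : (0 : ℝ) < (L : ℝ) ^ j := by
    have : (1 : ℝ) ≤ L := by exact_mod_cast hL1
    positivity
  have hkey : (L : ℝ) ^ j * (c * ((L : ℝ) ^ j)⁻¹) = c := by field_simp
  have hb : 0 ≤ c * ((L : ℝ) ^ j)⁻¹ := by positivity
  have h := eq214_local hL hG hU₀ hα hα3 hα4 h33 hb h69 (by rw [hkey]; exact hsmall) (by rw [hkey]; exact hc₃)
    (by rw [hkey]; exact hs) hL1 hα₄ h177b h177a (by rw [hkey]; exact hα₃') hs₁ hs₂ (by rw [hkey]; exact hs₃) hs₄ hs₅ hs₆ hs₇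
    hmn z hz hz'
  rw [hkey] at h
  rw [Qnl_eq_mlog_utilG, qprimeIter_bgT_eq_lamAvgG]
  exact h

end Local

end Literature.MathematicalPhysics.QuantumFieldTheory.Balaban1983to89.B8Eq1115Concrete

end
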